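import Literature.Geometry.Lorentzian.AdiabaticTracking
import Summits.FinalStateConjecture.FinalStateConjecture.Statement
import Summits.FinalStateConjecture.FinalStateConjecture.Theorems.ClusterCompletenessRecurrentlyFlatDispersesRestart
import Summits.FinalStateConjecture.FinalStateConjecture.Theorems.ClusterCompletenessLinearToNonlinearCaptureStubIsOpenSubsetChronologicalPast
import HarnessLib

/-!
# Crux `DriftCapture` (stmt-FinalStateConjecture-17391), stub `stub_flatLateChartOfTracking`:
# the orientation clause of the anchored flat late chart is automatic

The registered stub `stub_flatLateChartOfTracking` (ASSEMBLE at `N = 0`) of the skeleton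
`Summits/FinalStateConjecture/FinalStateConjecture/Cruxes/DriftCapture/Lines/birth.lean` asks, from
all-accuracy adiabatic tracking with NO hole, for ONE anchored flat late chart of a maximal vacuum
Cauchy development `𝒟` of admissible data: a flat domain `U₁ ⊇ {x⁰ > τ₁}`, a late chart
`Φ : U₁ → 𝒟` into its self-determined exterior `J⁺(ι X) ∩ I⁻(Φ{x⁰ > τ₁})` with
`C²`-deviation from `η` tending to `0` on the entire slabs `{x⁰ = τ}`, uncharted part below every
slab (FOUR clauses), AND (fifth clause) `Φ_* ∂₀` eventually future-directed.

This file proves that the FIFTH CLAUSE FOLLOWS FROM THE OTHER FOUR (indeed from the first, second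
and fourth together with a `C⁰` anchor `‖Φ^* g − η‖ ≤ 1/4` from some chart time on, which the third
supplies eventually): the `N = 0` twin of the landed `lateChartsOfPinnedTracking_of_unoriented` /
`decomposition_of_unorientedLateCharts` (orthochronicity of the hole motions dropped for `N ≥ 1`).
The geometric input is the landed non-imprisonment argument of the sister crux
`RecurrentlyFlatDisperses` (stmt-FinalStateConjecture-14665, line `Sketch`):
`RecurrentlyFlatDisperses.stub_chartFuture` (a past-directed chart vertical would be a past-endless
timelike ray imprisoned in the compact `J⁻(Φ x) ∩ J⁺(Σ)` of the globally hyperbolic development)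
fed with `RecurrentlyFlatDisperses.stub_anchorCone`, applied to the chart RESTARTED at an anchor
time `T ≥ τ₁` — the restart needs no orientation: the late image `Φ{x⁰ > T}` is open, hence lies in
its own chronological past (`stub_isOpen_subset_chronologicalPast`), it lies in `J⁺(ι X)` because
`Φ{x⁰ > τ₁}` does, and the exhaustion clause is inherited through
`exteriorOf 𝒟 (Φ{x⁰ > T}) ⊆ exteriorOf 𝒟 (Φ{x⁰ > τ₁})` (`RecurrentlyFlatDisperses.Restart.exteriorOf_mono`).

* `isFutureDirected_of_anchoredFlatChart` — four clauses + `C⁰` anchor after `T` ⇒ `Φ_* ∂₀`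
  future-directed at every point of `{x⁰ > T}`;
* `eventually_isFutureDirected_of_convergentFlatChart` — four clauses with `C²` convergence ⇒ the
  fifth clause;
* `flatLateChart_of_convergentFlatChart` — hence the four-clause anchored convergent flat chart
  (verbatim the hypothesis of `RecurrentlyFlatDisperses.decomp_of_convergentChart`, p128814, and the
  conclusion shape of that line's open half "(B) recurrence ⇒ convergence",
  `Cruxes/RecurrentlyFlatDisperses/Lines/Sketch-dead.md` §3) gives the stub's five-clause conclusion;
* `stub_flatLateChartOfTracking_of_unoriented` — so the registered stub follows VERBATIM from the
  same statement with the orientation clause deleted.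

Consequence for the crux: the `N = 0` ASSEMBLE target of `DriftCapture` and the convergent anchored
chart of `RecurrentlyFlatDisperses` are ONE object; the two cruxes share the analytic core
"all-accuracy / recurrent unweighted slab flatness ⇒ one convergent global flat gauge".

Mathlib + landed `Theorems` of the two cruxes only; no definitions, no named facts, no `sorry`.

References: O'Neill 1983, Ch. 14, Lemma 14.13 (non-imprisonment in strongly causal spacetimes) and
pp. 402–403 (`I⁻` of an open set); Bernal–Sánchez, Class. Quantum Grav. 24 (2007) 745, Thm. 3.2;
Dafermos–Luk arXiv:1710.01722, Conjecture 1 (`N = 0` shape); Christodoulou–Klainerman 1993, Thm. 1.0.2.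
-/

-- the doubled `FinalStateConjecture.FinalStateConjecture` path component trips dupNamespace
set_option linter.dupNamespace false

noncomputable section

namespace Summit.FinalStateConjecture.FinalStateConjecture.Theorems.RenormalisedDrift.DriftCapture

open Set Filter Topology TopologicalSpace
open scoped Manifold ContDiff ENNReal
open Literature.Geometry.Lorentzian

/-- **Chart time of an anchored flat late chart runs to the future.** Let `𝒟` be a maximal vacuum
Cauchy development of an admissible datum and `Φ : U₁ → 𝒟`, `U₁ ⊇ {x⁰ > τ₁}`, a late chart into its
self-determined exterior `J⁺(ι X) ∩ I⁻(Φ{x⁰ > τ₁})` whose uncharted part beyond every chart time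
`τ ≥ τ₁` lies causally below the slab `Φ{x⁰ = τ}`. If from some chart time `T ≥ τ₁` on the `C⁰`
deviation satisfies `‖Φ^* g − η‖_{C⁰({x⁰ = τ})} ≤ 1/4`, then `Φ_* ∂₀` is future-directed at EVERY
point of `{x⁰ > T}`. Proof: restart the chart at `T` (open image ⊆ its own `I⁻`; `⊆ J⁺(ι X)`;
exhaustion inherited by monotonicity of `exteriorOf`) and apply the landed non-imprisonment argument
`RecurrentlyFlatDisperses.stub_chartFuture` with `RecurrentlyFlatDisperses.stub_anchorCone`.
[cite: ONeill1983, Ch. 14, Lemma 14.13 and pp. 402–403] -/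
theorem isFutureDirected_of_anchoredFlatChart :
    ∀ (X : Type) [TopologicalSpace X] [ChartedSpace E3 X]
      [IsManifold (𝓡 3) ((⊤ : ℕ∞) : WithTop ℕ∞) X] [T2Space X] [SecondCountableTopology X]
      [ConnectedSpace X], ∀ D ∈ admissibleVacuumData X, ∀ 𝒟 : VacuumCauchyDevelopment D,
      𝒟.IsMaximal → ∀ (τ₁ : ℝ) (U₁ : Opens E4) (Φ : U₁ → 𝒟.carrier),
        {x : E4 | τ₁ < x 0} ⊆ (U₁ : Set E4) →
        𝒟.toSpacetime.IsLateChart (Minkowski.backgroundOn U₁)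
          (Summit.FinalStateConjecture.exteriorOf 𝒟.toCauchyDevelopment
            (Φ '' (Minkowski.backgroundOn U₁).lateRegion τ₁)) τ₁ Φ →
        (∀ τ : ℝ, τ₁ ≤ τ →
          Summit.FinalStateConjecture.exteriorOf 𝒟.toCauchyDevelopment
              (Φ '' (Minkowski.backgroundOn U₁).lateRegion τ₁) \
                Φ '' (Minkowski.backgroundOn U₁).lateRegion τ ⊆
            𝒟.metric.causalPast 𝒟.timeOrientation (Φ '' (Minkowski.backgroundOn U₁).timeSlab τ)) →
        ∀ T : ℝ, τ₁ ≤ T →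
          (∀ τ : ℝ, T < τ →
            𝒟.toSpacetime.deviationCk (Minkowski.backgroundOn U₁) Φ 0 τ ≤ ENNReal.ofReal (1 / 4)) →
          ∀ x : U₁, T < x.1 0 →
            𝒟.toSpacetime.timeOrientation.IsFutureDirected
              (mfderiv 𝓘(ℝ, E4) (𝓡 4) Φ x (E4.basisVector 0)) := by
  intro X _ _ _ _ _ _ D hD 𝒟 hmax τ₁ U₁ Φ hU hlate hexh T hT hC0 x hx
  -- notation: `W_σ = Φ{x⁰ > σ}`; the restarted region `O_T = J⁺(ι X) ∩ I⁻(W_T)`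
  have hsub : (Minkowski.backgroundOn U₁).lateRegion T ⊆ (Minkowski.backgroundOn U₁).lateRegion τ₁ :=
    (Minkowski.backgroundOn U₁).lateRegion_mono hT
  have hWW : Φ '' (Minkowski.backgroundOn U₁).lateRegion T ⊆
      Φ '' (Minkowski.backgroundOn U₁).lateRegion τ₁ := image_mono hsub
  have hOO : Summit.FinalStateConjecture.exteriorOf 𝒟.toCauchyDevelopment
        (Φ '' (Minkowski.backgroundOn U₁).lateRegion T) ⊆
      Summit.FinalStateConjecture.exteriorOf 𝒟.toCauchyDevelopment
        (Φ '' (Minkowski.backgroundOn U₁).lateRegion τ₁) :=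
    RecurrentlyFlatDisperses.Restart.exteriorOf_mono 𝒟.toCauchyDevelopment hWW
  -- the open embedding restricts from `{x⁰ > τ₁}` to its open subset `{x⁰ > T}`
  have hopen : IsOpen ((Minkowski.backgroundOn U₁).lateRegion T) := by
    have hcont : Continuous fun y : U₁ ↦ (y : E4) 0 :=
      (PiLp.continuous_apply 2 _ 0).comp continuous_subtype_val
    exact isOpen_lt continuous_const hcont
  have hOE : Topology.IsOpenEmbedding (((Minkowski.backgroundOn U₁).lateRegion T).restrict Φ) := by
    have hincl : Topology.IsOpenEmbedding (inclusion hsub) :=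
      Topology.IsOpenEmbedding.inclusion hsub (hopen.preimage continuous_subtype_val)
    exact hlate.isOpenEmbedding.comp hincl
  -- `W_T` is open, hence `W_T ⊆ I⁻(W_T)`
  have hWopen : IsOpen (Φ '' (Minkowski.backgroundOn U₁).lateRegion T) := by
    rw [← range_restrict]
    exact hOE.isOpen_range
  -- the anchored hypothesis of crux `RecurrentlyFlatDisperses` at base time `T`
  have hyp : 𝒟.toSpacetime.IsLateChart (Minkowski.backgroundOn U₁)
        (Summit.FinalStateConjecture.exteriorOf 𝒟.toCauchyDevelopment
          (Φ '' (Minkowski.backgroundOn U₁).lateRegion T)) T Φ ∧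
      {x : E4 | T < x 0} ⊆ (U₁ : Set E4) ∧
      Summit.FinalStateConjecture.exteriorOf 𝒟.toCauchyDevelopment
          (Φ '' (Minkowski.backgroundOn U₁).lateRegion T) =
        Summit.FinalStateConjecture.exteriorOf 𝒟.toCauchyDevelopment
          (Φ '' (Minkowski.backgroundOn U₁).lateRegion T) ∧
      (∀ τ' : ℝ, T < τ' →
        Summit.FinalStateConjecture.exteriorOf 𝒟.toCauchyDevelopment
            (Φ '' (Minkowski.backgroundOn U₁).lateRegion T) \
              Φ '' (Minkowski.backgroundOn U₁).lateRegion τ' ⊆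
          𝒟.metric.causalPast 𝒟.timeOrientation
            (Φ '' (Minkowski.backgroundOn U₁).timeSlab τ')) ∧
      (∀ τ : ℝ, T < τ →
        𝒟.toSpacetime.deviationCk (Minkowski.backgroundOn U₁) Φ 0 τ ≤ ENNReal.ofReal (1 / 4)) := by
    refine ⟨⟨hlate.contMDiff, hOE, fun q hq ↦ ⟨(hlate.image_subset (hWW hq)).1, ?_⟩⟩,
      fun y hy ↦ hU (lt_of_le_of_lt hT hy), rfl, fun τ' hτ' q hq ↦ ?_, hC0⟩
    · -- `W_T ⊆ I⁻(W_T)`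
      exact stub_isOpen_subset_chronologicalPast 𝒟.toSpacetime hWopen hq
    · -- exhaustion from `T` on, inherited through `O_T ⊆ O_{τ₁}`
      exact hexh τ' (hT.trans hτ'.le) ⟨hOO hq.1, hq.2⟩
  exact RecurrentlyFlatDisperses.stub_chartFuture RecurrentlyFlatDisperses.stub_anchorCone X D hD 𝒟
    hmax _ T U₁ Φ hyp x hx

/-- **A convergent anchored flat late chart is eventually future-oriented.** In the setting of
`isFutureDirected_of_anchoredFlatChart`, if the `C²` deviation `‖Φ^* g − η‖_{C²({x⁰ = τ})}` tends
to `0`, then eventually in chart time, at every point of the slab `{x⁰ = τ}`, `Φ_* ∂₀` is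
future-directed: the `C⁰` anchor `≤ 1/4` holds from some time on (`C⁰ ≤ C²` sup norms).
[cite: ONeill1983, Ch. 14, Lemma 14.13 and pp. 402–403] -/
theorem eventually_isFutureDirected_of_convergentFlatChart :
    ∀ (X : Type) [TopologicalSpace X] [ChartedSpace E3 X]
      [IsManifold (𝓡 3) ((⊤ : ℕ∞) : WithTop ℕ∞) X] [T2Space X] [SecondCountableTopology X]
      [ConnectedSpace X], ∀ D ∈ admissibleVacuumData X, ∀ 𝒟 : VacuumCauchyDevelopment D,
      𝒟.IsMaximal → ∀ (τ₁ : ℝ) (U₁ : Opens E4) (Φ : U₁ → 𝒟.carrier),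
        {x : E4 | τ₁ < x 0} ⊆ (U₁ : Set E4) →
        𝒟.toSpacetime.IsLateChart (Minkowski.backgroundOn U₁)
          (Summit.FinalStateConjecture.exteriorOf 𝒟.toCauchyDevelopment
            (Φ '' (Minkowski.backgroundOn U₁).lateRegion τ₁)) τ₁ Φ →
        Tendsto (fun τ ↦ 𝒟.toSpacetime.deviationCk (Minkowski.backgroundOn U₁) Φ 2 τ)
          atTop (𝓝 0) →
        (∀ τ : ℝ, τ₁ ≤ τ →
          Summit.FinalStateConjecture.exteriorOf 𝒟.toCauchyDevelopment
              (Φ '' (Minkowski.backgroundOn U₁).lateRegion τ₁) \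
                Φ '' (Minkowski.backgroundOn U₁).lateRegion τ ⊆
            𝒟.metric.causalPast 𝒟.timeOrientation (Φ '' (Minkowski.backgroundOn U₁).timeSlab τ)) →
        ∀ᶠ τ in atTop, ∀ x ∈ (Minkowski.backgroundOn U₁).timeSlab τ,
          𝒟.toSpacetime.timeOrientation.IsFutureDirected
            (mfderiv 𝓘(ℝ, E4) (𝓡 4) Φ x (E4.basisVector 0)) := by
  intro X _ _ _ _ _ _ D hD 𝒟 hmax τ₁ U₁ Φ hU hlate hdev hexh
  -- the `C²` (hence `C⁰`) deviation is eventually `≤ 1/4`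
  have hε : (0 : ℝ≥0∞) < ENNReal.ofReal (1 / 4) := ENNReal.ofReal_pos.2 (by norm_num)
  obtain ⟨T₀, hT₀⟩ := eventually_atTop.1 (hdev.eventually (ge_mem_nhds hε))
  have hC0 : ∀ τ : ℝ, max τ₁ T₀ < τ →
      𝒟.toSpacetime.deviationCk (Minkowski.backgroundOn U₁) Φ 0 τ ≤ ENNReal.ofReal (1 / 4) :=
    fun τ hτ ↦ (𝒟.toSpacetime.deviationCk_mono (Minkowski.backgroundOn U₁) Φ (Nat.zero_le 2) τ).trans
      (hT₀ τ ((le_max_right τ₁ T₀).trans hτ.le))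
  have hfut := isFutureDirected_of_anchoredFlatChart X D hD 𝒟 hmax τ₁ U₁ Φ hU hlate hexh (max τ₁ T₀)
    (le_max_left τ₁ T₀) hC0
  filter_upwards [eventually_gt_atTop (max τ₁ T₀)] with τ hτ x hx
  have hx' : x.1 0 = τ := hx
  exact hfut x (by rw [hx']; exact hτ)

/-- **The anchored flat late chart of `DriftCapture` at `N = 0` needs no orientation clause.** For
a maximal vacuum Cauchy development of admissible data, a four-clause anchored convergent flat late
chart (`U₁ ⊇ {x⁰ > τ₁}`; late chart into `J⁺(ι X) ∩ I⁻(Φ{x⁰ > τ₁})`; `C²`-deviation `→ 0`;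
uncharted part below every slab — verbatim the hypothesis of the landed
`RecurrentlyFlatDisperses.decomp_of_convergentChart`) is a five-clause one (the same with `Φ_* ∂₀`
eventually future-directed — verbatim hypothesis (i) of the landed
`globalGauge_zero_of_flatLateChart`), with the same `(τ₁, U₁, Φ)`.
[cite: DafermosLuk2017, Conjecture 1] -/
theorem flatLateChart_of_convergentFlatChart :
    ∀ (X : Type) [TopologicalSpace X] [ChartedSpace E3 X]
      [IsManifold (𝓡 3) ((⊤ : ℕ∞) : WithTop ℕ∞) X] [T2Space X] [SecondCountableTopology X]
      [ConnectedSpace X], ∀ D ∈ admissibleVacuumData X, ∀ 𝒟 : VacuumCauchyDevelopment D,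
      𝒟.IsMaximal →
        (∃ (τ₁ : ℝ) (U₁ : Opens E4) (Φ : U₁ → 𝒟.carrier),
          {x : E4 | τ₁ < x 0} ⊆ (U₁ : Set E4) ∧
          𝒟.toSpacetime.IsLateChart (Minkowski.backgroundOn U₁)
            (Summit.FinalStateConjecture.exteriorOf 𝒟.toCauchyDevelopment
              (Φ '' (Minkowski.backgroundOn U₁).lateRegion τ₁)) τ₁ Φ ∧
          Tendsto (fun τ ↦ 𝒟.toSpacetime.deviationCk (Minkowski.backgroundOn U₁) Φ 2 τ)
            atTop (𝓝 0) ∧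
          (∀ τ : ℝ, τ₁ ≤ τ →
            Summit.FinalStateConjecture.exteriorOf 𝒟.toCauchyDevelopment
                (Φ '' (Minkowski.backgroundOn U₁).lateRegion τ₁) \
                  Φ '' (Minkowski.backgroundOn U₁).lateRegion τ ⊆
              𝒟.metric.causalPast 𝒟.timeOrientation
                (Φ '' (Minkowski.backgroundOn U₁).timeSlab τ))) →
        ∃ (τ₁ : ℝ) (U₁ : Opens E4) (Φ : U₁ → 𝒟.carrier),
          {x : E4 | τ₁ < x 0} ⊆ (U₁ : Set E4) ∧
          𝒟.toSpacetime.IsLateChart (Minkowski.backgroundOn U₁)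
            (Summit.FinalStateConjecture.exteriorOf 𝒟.toCauchyDevelopment
              (Φ '' (Minkowski.backgroundOn U₁).lateRegion τ₁)) τ₁ Φ ∧
          Tendsto (fun τ ↦ 𝒟.toSpacetime.deviationCk (Minkowski.backgroundOn U₁) Φ 2 τ)
            atTop (𝓝 0) ∧
          (∀ τ : ℝ, τ₁ ≤ τ →
            Summit.FinalStateConjecture.exteriorOf 𝒟.toCauchyDevelopment
                (Φ '' (Minkowski.backgroundOn U₁).lateRegion τ₁) \
                  Φ '' (Minkowski.backgroundOn U₁).lateRegion τ ⊆
              𝒟.metric.causalPast 𝒟.timeOrientation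
                (Φ '' (Minkowski.backgroundOn U₁).timeSlab τ)) ∧
          ∀ᶠ τ in atTop, ∀ x ∈ (Minkowski.backgroundOn U₁).timeSlab τ,
            𝒟.toSpacetime.timeOrientation.IsFutureDirected
              (mfderiv 𝓘(ℝ, E4) (𝓡 4) Φ x (E4.basisVector 0)) := by
  intro X _ _ _ _ _ _ D hD 𝒟 hmax h
  obtain ⟨τ₁, U₁, Φ, hU, hlate, hdev, hexh⟩ := h
  exact ⟨τ₁, U₁, Φ, hU, hlate, hdev, hexh,
    eventually_isFutureDirected_of_convergentFlatChart X D hD 𝒟 hmax τ₁ U₁ Φ hU hlate hdev hexh⟩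

/-- **The flat stub may drop its orientation clause.** The registered stub
`stub_flatLateChartOfTracking` of the skeleton `Cruxes/DriftCapture/Lines/birth.lean` (all-accuracy
adiabatic tracking with no hole ⇒ one anchored convergent flat late chart, five clauses; the
conclusion below is its registered signature verbatim) follows VERBATIM from the same statement
with the fifth clause (`Φ_* ∂₀` eventually future-directed) deleted from its conclusion, by
`flatLateChart_of_convergentFlatChart` — the `N = 0` twin of `lateChartsOfPinnedTracking_of_unoriented`.
[cite: DafermosLuk2017, Conjecture 1] -/
theorem stub_flatLateChartOfTracking_of_unoriented : (∀ (m₀ χ : ℝ), 0 < m₀ → 0 ≤ χ → χ < 1 → ∀ (X : Type) [TopologicalSpace X] [ChartedSpace E3 X] [IsManifold (𝓡 3) ((⊤ : ℕ∞) : WithTop ℕ∞) X] [T2Space X] [SecondCountableTopology X] [ConnectedSpace X], ∀ D ∈ admissibleVacuumData X, ∀ 𝒟 : VacuumCauchyDevelopment D, 𝒟.IsMaximal → Summit.FinalStateConjecture.HasCompleteNullInfinity 𝒟.toCauchyDevelopment → (∀ (L : ℝ) (ε : ENNReal) (R₀ : ℝ), 0 < L → 0 < ε → 𝒟.IsAdiabaticallyTracked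 0 m₀ χ ε L R₀) → ∃ (τ₁ : ℝ) (U₁ : TopologicalSpace.Opens E4) (Φ : U₁ → 𝒟.carrier), {x : E4 | τ₁ < x 0} ⊆ (U₁ : Set E4) ∧ 𝒟.toSpacetime.IsLateChart (Minkowski.backgroundOn U₁) (Summit.FinalStateConjecture.exteriorOf 𝒟.toCauchyDevelopment (Φ '' (Minkowski.backgroundOn U₁).lateRegion τ₁)) τ₁ Φ ∧ Tendsto (fun τ ↦ 𝒟.toSpacetime.deviationCk (Minkowski.backgroundOn U₁) Φ 2 τ) atTop (𝓝 0) ∧ (∀ τ : ℝ, τ₁ ≤ τ → Summit.FinalStateConjecture.exteriorOf 𝒟.toCauchyDevelopment (Φ '' (Minkowski.backgroundOn U₁).lateRegion τ₁) \ Φ '' (Minkowski.backgroundOn U₁).lateRegion τ ⊆ 𝒟.metric.causalPast 𝒟.timeOrientation (Φ '' (Minkowski.backgroundOn U₁).timeSlab τ))) → ∀ (m₀ χ : ℝ), 0 < m₀ → 0 ≤ χ → χ < 1 → ∀ (X : Type) [TopologicalSpace X] [ChartedSpace E3 X] [IsManifold (𝓡 3) ((⊤ : ℕ∞) : WithTop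 ℕ∞) X] [T2Space X] [SecondCountableTopology X] [ConnectedSpace X], ∀ D ∈ admissibleVacuumData X, ∀ 𝒟 : VacuumCauchyDevelopment D, 𝒟.IsMaximal → Summit.FinalStateConjecture.HasCompleteNullInfinity 𝒟.toCauchyDevelopment → (∀ (L : ℝ) (ε : ENNReal) (R₀ : ℝ), 0 < L → 0 < ε → 𝒟.IsAdiabaticallyTracked 0 m₀ χ ε L R₀) → ∃ (τ₁ : ℝ) (U₁ : TopologicalSpace.Opens E4) (Φ : U₁ → 𝒟.carrier), {x : E4 | τ₁ < x 0} ⊆ (U₁ : Set E4) ∧ 𝒟.toSpacetime.IsLateChart (Minkowski.backgroundOn U₁) (Summit.FinalStateConjecture.exteriorOf 𝒟.toCauchyDevelopment (Φ '' (Minkowski.backgroundOn U₁).lateRegion τ₁)) τ₁ Φ ∧ Tendsto (fun τ ↦ 𝒟.toSpacetime.deviationCk (Minkowski.backgroundOn U₁) Φ 2 τ) atTop (𝓝 0) ∧ (∀ τ : ℝ, τ₁ ≤ τ → Summit.FinalStateConjecture.exteriorOf 𝒟.toCauchyDevelopment (Φ '' (Minkowski.backgroundOn U₁).lateRegion τ₁)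 \ Φ '' (Minkowski.backgroundOn U₁).lateRegion τ ⊆ 𝒟.metric.causalPast 𝒟.timeOrientation (Φ '' (Minkowski.backgroundOn U₁).timeSlab τ)) ∧ ∀ᶠ τ in atTop, ∀ x ∈ (Minkowski.backgroundOn U₁).timeSlab τ, 𝒟.toSpacetime.timeOrientation.IsFutureDirected (mfderiv 𝓘(ℝ, E4) (𝓡 4) Φ x (E4.basisVector 0)) := by
  intro H m₀ χ hm₀ hχ₀ hχ₁ X _ _ _ _ _ _ D hD 𝒟 hmax hscri htrack
  exact flatLateChart_of_convergentFlatChart X D hD 𝒟 hmax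
    (H m₀ χ hm₀ hχ₀ hχ₁ X D hD 𝒟 hmax hscri htrack)

end Summit.FinalStateConjecture.FinalStateConjecture.Theorems.RenormalisedDrift.DriftCapture

end
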